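import Literature.MathematicalPhysics.QuantumLattice.KomaPiFluxInfraredBound
import HarnessLib

/-!
# Koma's Hamiltonian as printed — (2.4)–(2.9), (3.5)–(3.6) — and its conjugation to Lieb's frame

T. Koma, *Nambu–Goldstone modes for superconducting lattice fermions*, arXiv:2201.13135 (2022)
[Koma2022]. The files `BCSPairHoppingReflectionPositivity.lean`, `KomaPiFluxBCSModel.lean`,
`KomaPiFluxGaussianDomination.lean`, `KomaPiFluxInfraredBound.lean` work with the model in LIEB's
reflection frame, `KomaPiFlux.hamiltonian κ U g h B = K(T_π(κ)) + UΣ(n-½)(n-½)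
+ (g/8)Σ_{x∼y}{[Γ¹_x - Γ¹_y + h(x,y)]² + [Γ²_x - Γ²_y]²} - B Σ_x Γ²_x`. This file transcribes Koma's
printed Hamiltonian on the even torus `(ℤ/Lℤ)^D` (`D = d + 1` directions, Koma's `d`; side `L`
even, Koma's `2L`; his box `{-L+1, …, L}^d` in the translated coordinates `{0, …, 2L-1}^d`, all
of (2.5), (2.8), (2.9), (3.5) read verbatim in these coordinates):

* `printedAmpl κ` — the hopping (2.7)–(2.9): amplitude `iκ (-1)^{x(1)+⋯+x(i-1)}` on
  `a†_x a_{x+e_i}` for `x(i) ≠ 2L-1` and `-iκ (-1)^{x(1)+⋯+x(i-1)}` on the boundary bond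
  `a†_{x⁺_i} a_{x⁻_i}` (antiperiodic boundary condition), in the tree's convention
  `K(T) = -Σ_σ Σ_{x,y} T_σ(x,y) a†_{x,σ} a_{y,σ}` of `peierlsHubbard`;
* `printedPair g h` — `H_int(h)` of (3.5) literally:
  `(g/4)ΣₓΣ_m [Γ¹_x + Γ¹_{x+e_m} + (-1)^{x(1)+⋯+x(d)} h_m(x)]² - (g/4)ΣₓΣ_m [Γ²_x - Γ²_{x+e_m}]²
   - (dg/2)Σₓ{[Γ¹_x]² - [Γ²_x]²}` for `d` real functions `h = (h_1, …, h_d)` (here `h : Fin D → Λ → ℝ`);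
* `printedOrder` — `O = Σ_x (-1)^{x(1)+⋯+x(d)} Γ²_x` of (2.5)/(3.3);
* `printedHamiltonian κ g h B = K + H_int(h) - B·O` — (3.6) with `g' = 0` (Koma §3: "We will
  consider first the case with `g' = 0`"; the `g'`-term of (2.6) is not transcribed).

and PROVES the identification announced in the module docstrings of the previous files:

* `komaPhase` — the unitary `𝒰 = e^{(iπ/2) Σ_{x odd} n_x} · ∏_x φ(x)^{n_x}` (`x` odd iff
  `x(1)+⋯+x(d)` odd; `φ(x) = (-1)^{Σ_{i<j} x(i)x(j)} ∏_j ω(x(j))` a `ℤ₂` gauge — the product of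
  Koma's `U_HA(i,j)` of (4.5) over all pairs and of seam-relocating gauges of §4.1), as phases
  for the tree's `orbitalPhaseAut`; `𝒰 Γ^{1,2}_x 𝒰† = (-1)^x Γ^{1,2}_x` (cf. (6.5)) and
  `𝒰 K(T_π(κ)) 𝒰† = K(printedAmpl κ)` (`komaPhase_piFluxAmpl`);
* **`orbitalPhaseAut_hamiltonian_eq_printed`** —
  `𝒰 · KomaPiFlux.hamiltonian κ (-2Dg) g (bondField h) B · 𝒰† = printedHamiltonian κ g h B + (Dg|Λ|/2)·1`,
  where `bondField h (x, x+e_m) = h_m(x) = -bondField h (x+e_m, x)`; the `U`-shift `-2Dg` and the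
  constant come from `(g/4)[Γ²_x + Γ²_y]² = -(g/4)[Γ²_x - Γ²_y]² + (g/2)([Γ²_x]² + [Γ²_y]²)` and
  Koma's (3.7)–(3.8), `[Γ¹_x]² = [Γ²_x]² = 2(n_{x↑}-½)(n_{x↓}-½) + ½` (`gammaOne_mul_self_eq`);
* hence `partitionFn_printed` (`Z` of (3.6) `= e^{-βDg|Λ|/2} Z` of Lieb's frame), the sign-of-`κ`
  symmetry `partitionFn_neg_kappa`, and **Theorem 5.3 (5.100) for the printed Hamiltonian and
  every real `κ`**: `printed_partitionFn_le : Tr e^{-βH(B,h)} ≤ Tr e^{-βH(B,0)}`.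

## References

* [Koma2022] T. Koma, arXiv:2201.13135, (2.4)–(2.9), (3.1)–(3.8), §4.1–4.2, Thm. 5.3, (6.5).
* [Lieb1994] E. H. Lieb, Phys. Rev. Lett. 73 (1994) 2158, p. 3 (gauge transformations).
-/

noncomputable section

namespace Literature.MathematicalPhysics.QuantumLattice

open Matrix Finset HubbardWave0 NormedSpace PairHopRP LiebCutRP PairHopCutRP
open FermionTorus.Cut
open FermionTorus (shift unshift shift_unshift unshift_shift shift_injective shift_ne_unshift
  adj_iff_shift_or_unshift shiftEquiv shiftEquiv_apply ofLex_shift sum_shift_add_sum_shift_swap)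

namespace KomaPiFlux

attribute [local instance] LiebCutRP.decEqTorus

variable {d L : ℕ} [NeZero L]

/-! ### Koma's printed Hamiltonian (translated coordinates) -/

section Printed

/-- `x(1) + ⋯ + x(d)` (the parity exponent of the site `x`). [cite: Koma2022, (2.5)] -/
def siteParity (x : FermionTorus (d + 1) L) : ℕ := ∑ j : Fin (d + 1), (ofLex x j : ℕ)

/-- `(-1)^{x(1)+⋯+x(d)}`. [cite: Koma2022, (2.5)] -/
def stagSign (x : FermionTorus (d + 1) L) : ℝ := (-1) ^ siteParity x

/-- `(-1)^{x(1)+⋯+x(i-1)}`, the sign of the hopping in direction `i` (here `μ`, 0-indexed).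
[cite: Koma2022, (2.9)] -/
def stair (x : FermionTorus (d + 1) L) (μ : Fin (d + 1)) : ℝ :=
  (-1) ^ (∑ k ∈ (univ : Finset (Fin (d + 1))).filter (· < μ), (ofLex x k : ℕ))

/-- The antiperiodic boundary condition: `-1` on the boundary bond `{x⁺_i, x⁻_i}` (`x(i) = 2L - 1`
in translated coordinates), `+1` otherwise. [cite: Koma2022, (2.8)–(2.9)] -/
def seamSign (x : FermionTorus (d + 1) L) (μ : Fin (d + 1)) : ℝ :=
  if (ofLex x μ : ℕ) + 1 = L then -1 else 1

/-- **The hopping amplitudes of (2.7)–(2.9)** in the convention `K(T) = -Σ T_σ(x,y) a†_{x,σ}a_{y,σ}`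
of `peierlsHubbard`: `T(x, x+e_i) = -iκ (-1)^{x(1)+⋯+x(i-1)} · (seam sign)`,
`T(x+e_i, x) = +iκ (-1)^{x(1)+⋯+x(i-1)} · (seam sign)`, i.e. the term
`iκ(-1)^{x(1)+⋯+x(i-1)}[a†_x a_{x+e_i} - a†_{x+e_i} a_x]` of (2.9) and, on the boundary bond,
`-iκ(-1)^{⋯}[a†_{x⁺} a_{x⁻} - a†_{x⁻} a_{x⁺}]`. [cite: Koma2022, (2.7)–(2.9)] -/
def printedAmpl (κ : ℝ) : Fin 2 → FermionTorus (d + 1) L → FermionTorus (d + 1) L → ℂ :=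
  fun _ x y => ∑ μ : Fin (d + 1),
    ((if y = shift x μ then -Complex.I * ((κ * stair x μ * seamSign x μ : ℝ) : ℂ) else 0) +
      (if x = shift y μ then Complex.I * ((κ * stair y μ * seamSign y μ : ℝ) : ℂ) else 0))

/-- **`H_int(h)` of (3.5), literally** (`d` real functions `h_m`, `m = 1, …, d`; here
`h : Fin D → Λ → ℝ`). [cite: Koma2022, (3.5)] -/
def printedPair (g : ℝ) (h : Fin (d + 1) → FermionTorus (d + 1) L → ℝ) :
    Matrix (Finset (Orb (FermionTorus (d + 1) L))) (Finset (Orb (FermionTorus (d + 1) L))) ℂ :=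
  ((g / 4 : ℝ) : ℂ) • ∑ x : FermionTorus (d + 1) L, ∑ μ : Fin (d + 1),
      (gammaOne x + gammaOne (shift x μ) + ((stagSign x * h μ x : ℝ) : ℂ) • 1) *
        (gammaOne x + gammaOne (shift x μ) + ((stagSign x * h μ x : ℝ) : ℂ) • 1) -
    ((g / 4 : ℝ) : ℂ) • ∑ x : FermionTorus (d + 1) L, ∑ μ : Fin (d + 1),
      (gammaTwo x - gammaTwo (shift x μ)) * (gammaTwo x - gammaTwo (shift x μ)) -
    (((d + 1 : ℕ) * g / 2 : ℝ) : ℂ) • ∑ x : FermionTorus (d + 1) L,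
      (gammaOne x * gammaOne x - gammaTwo x * gammaTwo x)

/-- **The order parameter `O = Σ_x (-1)^{x(1)+⋯+x(d)} Γ²_x`** of (2.5)/(3.3). [cite: Koma2022, (2.5), (3.3)] -/
def printedOrder : Matrix (Finset (Orb (FermionTorus (d + 1) L))) (Finset (Orb (FermionTorus (d + 1) L))) ℂ :=
  ∑ x : FermionTorus (d + 1) L, (stagSign x : ℂ) • gammaTwo x

/-- **Koma's Hamiltonian `H(B, h) = H_hop + H_int(h) - B·O`** of (3.6) (with `g' = 0`).
[cite: Koma2022, (2.4), (3.6)] -/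
def printedHamiltonian (κ g : ℝ) (h : Fin (d + 1) → FermionTorus (d + 1) L → ℝ) (B : ℝ) :
    Matrix (Finset (Orb (FermionTorus (d + 1) L))) (Finset (Orb (FermionTorus (d + 1) L))) ℂ :=
  peierlsHubbard (G d L) (printedAmpl κ) 0 + printedPair g h - (B : ℂ) • printedOrder

/-- The antisymmetric ordered-bond field of Koma's `d` functions: `h(x, x+e_m) = h_m(x)`,
`h(x+e_m, x) = -h_m(x)`. [cite: Koma2022, (3.5) with (5.93)/(5.96) (orientation sign)] -/
def bondField (h : Fin (d + 1) → FermionTorus (d + 1) L → ℝ) :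
    FermionTorus (d + 1) L → FermionTorus (d + 1) L → ℝ :=
  fun x y => ∑ μ : Fin (d + 1), ((if y = shift x μ then h μ x else 0) - (if x = shift y μ then h μ y else 0))

/-- On a bond `(x, x + e_μ)` the bond field is `h_μ(x)` (`L ≥ 3`). [cite: Koma2022, (3.5)] -/
theorem bondField_shift (h3 : 3 ≤ L) (h : Fin (d + 1) → FermionTorus (d + 1) L → ℝ)
    (x : FermionTorus (d + 1) L) (μ : Fin (d + 1)) : bondField h x (shift x μ) = h μ x := by
  have h2 : 2 ≤ L := by omega
  unfold bondField
  rw [Finset.sum_eq_single μ]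
  · rw [if_pos rfl, if_neg, sub_zero]
    intro hx
    have h' := congrArg (fun z => unshift z μ) hx
    simp only [unshift_shift] at h'
    exact shift_ne_unshift h3 x μ μ h'.symm
  · intro ν _ hν
    rw [if_neg (fun h => hν (shift_injective h2 x h).symm), if_neg, sub_zero]
    intro hx
    have h' := congrArg (fun z => unshift z ν) hx
    simp only [unshift_shift] at h'
    exact shift_ne_unshift h3 x μ ν h'.symm
  · exact fun h => absurd (Finset.mem_univ μ) h

/-- On the reversed bond `(x + e_μ, x)` the bond field is `-h_μ(x)`. [cite: Koma2022, (5.93)/(5.96)] -/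
theorem bondField_shift' (h3 : 3 ≤ L) (h : Fin (d + 1) → FermionTorus (d + 1) L → ℝ)
    (x : FermionTorus (d + 1) L) (μ : Fin (d + 1)) : bondField h (shift x μ) x = -h μ x := by
  have hanti : ∀ a b : FermionTorus (d + 1) L, bondField h b a = -bondField h a b := fun a b => by
    unfold bondField
    rw [← Finset.sum_neg_distrib]
    exact Finset.sum_congr rfl fun ν _ => by ring
  rw [hanti, bondField_shift h3]

/-- `printedAmpl κ (x, x + e_μ) = -iκ · stair · seam`. [cite: Koma2022, (2.8)–(2.9)] -/
theorem printedAmpl_shift (h3 : 3 ≤ L) (κ : ℝ) (σ : Fin 2) (x : FermionTorus (d + 1) L) (μ : Fin (d + 1)) :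
    printedAmpl κ σ x (shift x μ) = -Complex.I * ((κ * stair x μ * seamSign x μ : ℝ) : ℂ) := by
  have h2 : 2 ≤ L := by omega
  unfold printedAmpl
  rw [Finset.sum_eq_single μ]
  · rw [if_pos rfl, if_neg, add_zero]
    intro hx
    have h' := congrArg (fun z => unshift z μ) hx
    simp only [unshift_shift] at h'
    exact shift_ne_unshift h3 x μ μ h'.symm
  · intro ν _ hν
    rw [if_neg (fun h => hν (shift_injective h2 x h).symm), if_neg, add_zero]
    intro hx
    have h' := congrArg (fun z => unshift z ν) hx
    simp only [unshift_shift] at h'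
    exact shift_ne_unshift h3 x μ ν h'.symm
  · exact fun h => absurd (Finset.mem_univ μ) h

/-- `printedAmpl` is Hermitian. [cite: Koma2022, (2.7)] -/
theorem printedAmpl_herm (κ : ℝ) (σ : Fin 2) (x y : FermionTorus (d + 1) L) :
    printedAmpl κ σ y x = star (printedAmpl κ σ x y) := by
  unfold printedAmpl
  rw [star_sum]
  refine Finset.sum_congr rfl fun μ _ => ?_
  rw [star_add, add_comm]
  congr 1
  · split_ifs <;> simp [Complex.conj_ofReal]
  · split_ifs <;> simp [Complex.conj_ofReal]

end Printed

/-! ### The unitary `𝒰`: the sublattice rotation and the `ℤ₂` gauge -/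

section Gauge

/-- The phases `i^{[x odd]}` of `e^{(iπ/2) Σ_{x odd} n_x}`. [cite: Koma2022, (5.12) (cf. (6.5))] -/
def rotPhase (x : FermionTorus (d + 1) L) : ℂ := if Even (siteParity x) then 1 else Complex.I

/-- The quadratic form `Σ_{i<j} x(i) x(j)` of the direction-interchange gauges `U_HA(i,j)`,
(4.5), multiplied over all pairs `i < j`. [cite: Koma2022, (4.5)] -/
def quadForm (x : FermionTorus (d + 1) L) : ℕ :=
  ∑ i : Fin (d + 1), ∑ j : Fin (d + 1), if i < j then (ofLex x i : ℕ) * (ofLex x j : ℕ) else 0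

/-- The one-dimensional seam gauge `ω(c) = (-1)^{c(c-1)/2 + (c - L/2)₊}` with
`ω(c)ω(c+1) = (-1)^c w(c)`, `w = +1` below `L/2`, `-1` from `L/2` on. [cite: Koma2022, §4.1 (4.1)] -/
def omega1 (L c : ℕ) : ℝ := (-1) ^ (c * (c - 1) / 2 + (c - L / 2))

/-- The `ℤ₂` gauge `φ(x) = (-1)^{Σ_{i<j} x(i)x(j)} ∏_j ω(x(j))`. [cite: Koma2022, §4.1 (4.1), §4.2 (4.5)] -/
def komaGauge (x : FermionTorus (d + 1) L) : ℝ :=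
  (-1) ^ quadForm x * ∏ μ : Fin (d + 1), omega1 L (ofLex x μ : ℕ)

/-- The phases of `𝒰 = e^{(iπ/2)Σ_{x odd} n_x} ∏_x φ(x)^{n_x}` (spin independent). [cite: Koma2022, (4.1), (4.5), (5.12)] -/
def komaPhase : Fin 2 → FermionTorus (d + 1) L → ℂ := fun _ x => rotPhase x * (komaGauge x : ℂ)

omit [NeZero L] in
/-- `stagSign x = ±1`. [cite: Koma2022, (2.5)] -/
theorem stagSign_sq (x : FermionTorus (d + 1) L) : stagSign x * stagSign x = 1 := by
  rw [stagSign, ← pow_add, ← two_mul, pow_mul, neg_one_sq, one_pow]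

omit [NeZero L] in
/-- `komaGauge x = ±1`. [cite: Koma2022, §4.1–4.2] -/
theorem komaGauge_sq (x : FermionTorus (d + 1) L) : komaGauge x * komaGauge x = 1 := by
  have h1 : ∀ n : ℕ, ((-1 : ℝ) ^ n) * (-1) ^ n = 1 := fun n => by
    rw [← pow_add, ← two_mul, pow_mul, neg_one_sq, one_pow]
  rw [komaGauge, mul_mul_mul_comm, h1, one_mul, ← Finset.prod_mul_distrib]
  exact Finset.prod_eq_one fun μ _ => h1 _

omit [NeZero L] in
/-- `rotPhase x · rotPhase x = (-1)^x`. [cite: Koma2022, (6.5)] -/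
theorem rotPhase_mul_self (x : FermionTorus (d + 1) L) : rotPhase x * rotPhase x = (stagSign x : ℂ) := by
  unfold rotPhase stagSign
  split_ifs with h
  · rw [h.neg_one_pow, one_mul, Complex.ofReal_one]
  · rw [Complex.I_mul_I, (Nat.not_even_iff_odd.1 h).neg_one_pow]
    push_cast
    rfl

omit [NeZero L] in
/-- `|rotPhase x| = 1`. [cite: Koma2022, (5.12)] -/
theorem norm_rotPhase (x : FermionTorus (d + 1) L) : ‖rotPhase x‖ = 1 := by
  unfold rotPhase; split_ifs <;> simp

omit [NeZero L] in
/-- The phases of `𝒰` are unimodular. [cite: Koma2022, (4.1), (5.12)] -/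
theorem norm_komaPhase (σ : Fin 2) (x : FermionTorus (d + 1) L) : ‖komaPhase σ x‖ = 1 := by
  have h := komaGauge_sq x
  have : komaGauge x = 1 ∨ komaGauge x = -1 := by
    have : (komaGauge x - 1) * (komaGauge x + 1) = 0 := by nlinarith [h]
    rcases mul_eq_zero.1 this with h' | h'
    · exact Or.inl (by linarith)
    · exact Or.inr (by linarith)
  unfold komaPhase
  rw [norm_mul, norm_rotPhase, one_mul]
  rcases this with h' | h' <;> simp [h']

omit [NeZero L] in
/-- `𝒰`: `g_↑(x) g_↓(x) = (-1)^x` — so `𝒰 Γ^{±}_x 𝒰† = (-1)^x Γ^{±}_x`. [cite: Koma2022, (6.5)] -/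
theorem komaPhase_mul (x : FermionTorus (d + 1) L) : komaPhase 0 x * komaPhase 1 x = (stagSign x : ℂ) := by
  unfold komaPhase
  rw [mul_mul_mul_comm, rotPhase_mul_self, ← Complex.ofReal_mul, komaGauge_sq, Complex.ofReal_one, mul_one]

omit [NeZero L] in
/-- `𝒰 Γ¹_x 𝒰† = (-1)^x Γ¹_x`. [cite: Koma2022, (6.5)] -/
theorem komaPhase_gammaOne (x : FermionTorus (d + 1) L) :
    orbitalPhaseAut (g := spinSitePhase komaPhase) (fun _ => norm_komaPhase _ _) (gammaOne x) =
      (stagSign x : ℂ) • gammaOne x := by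
  rw [gammaOne, map_add, orbitalPhaseAut_gammaPlus, orbitalPhaseAut_gammaMinus, komaPhase_mul,
    Complex.star_def, Complex.conj_ofReal, smul_add]

omit [NeZero L] in
/-- `𝒰 Γ²_x 𝒰† = (-1)^x Γ²_x`. [cite: Koma2022, (6.5)] -/
theorem komaPhase_gammaTwo (x : FermionTorus (d + 1) L) :
    orbitalPhaseAut (g := spinSitePhase komaPhase) (fun _ => norm_komaPhase _ _) (gammaTwo x) =
      (stagSign x : ℂ) • gammaTwo x := by
  rw [gammaTwo, map_smul, map_sub, orbitalPhaseAut_gammaPlus, orbitalPhaseAut_gammaMinus, komaPhase_mul,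
    Complex.star_def, Complex.conj_ofReal, ← smul_sub, smul_comm]

/-! #### The parities along a bond -/

/-- `(-1)^{x + e_μ} = -(-1)^x` on the even torus (the lattice is bipartite). [cite: Koma2022, (2.5)] -/
theorem stagSign_shift (hL : Even L) (x : FermionTorus (d + 1) L) (μ : Fin (d + 1)) :
    stagSign (shift x μ) = -stagSign x := by
  rw [stagSign, stagSign, siteParity, siteParity, ← prod_pow_eq_pow_sum, ← prod_pow_eq_pow_sum,
    ← Finset.mul_prod_erase _ _ (Finset.mem_univ μ), ← Finset.mul_prod_erase _ _ (Finset.mem_univ μ),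
    ofLex_shift, Function.update_self, neg_one_pow_val_add_one hL, neg_mul]
  congr 2
  refine Finset.prod_congr rfl fun k hk => ?_
  rw [Function.update_of_ne (Finset.ne_of_mem_erase hk)]

/-- The parity of `x + e_μ` is opposite to that of `x`. [cite: Koma2022, (2.5)] -/
theorem even_siteParity_shift (hL : Even L) (x : FermionTorus (d + 1) L) (μ : Fin (d + 1)) :
    Even (siteParity (shift x μ)) ↔ ¬Even (siteParity x) := by
  have h := stagSign_shift hL x μ
  unfold stagSign at h
  constructor
  · intro he hx
    rw [he.neg_one_pow, hx.neg_one_pow] at h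
    norm_num at h
  · intro hx
    by_contra he
    rw [(Nat.not_even_iff_odd.1 he).neg_one_pow, (Nat.not_even_iff_odd.1 hx).neg_one_pow] at h
    norm_num at h

/-- `rotPhase x · conj(rotPhase (x + e_μ)) = -i (-1)^x`. [cite: Koma2022, (5.12)–(5.15)] -/
theorem rotPhase_mul_conj_shift (hL : Even L) (x : FermionTorus (d + 1) L) (μ : Fin (d + 1)) :
    rotPhase x * star (rotPhase (shift x μ)) = -Complex.I * (stagSign x : ℂ) := by
  unfold rotPhase stagSign
  by_cases hx : Even (siteParity x)
  · rw [if_pos hx, if_neg ((even_siteParity_shift hL x μ).not.2 (not_not.2 hx)), hx.neg_one_pow,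
      Complex.star_def, Complex.conj_I]
    push_cast
    ring
  · rw [if_neg hx, if_pos ((even_siteParity_shift hL x μ).2 hx), (Nat.not_even_iff_odd.1 hx).neg_one_pow,
      star_one]
    push_cast
    ring

/-! #### The quadratic form along a bond -/

omit [NeZero L] in
/-- `Σ_{i<j} x_i x_j = x_μ · Σ_{j≠μ} x_j + (terms without x_μ)`: the parity of the quadratic form
changes by `Σ_{j ≠ μ} x_j` when `x_μ` changes parity. [cite: Koma2022, (4.8)–(4.9)] -/
theorem quadForm_eq (x : FermionTorus (d + 1) L) (μ : Fin (d + 1)) :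
    quadForm x = (ofLex x μ : ℕ) * (∑ j ∈ (univ : Finset (Fin (d + 1))).erase μ, (ofLex x j : ℕ)) +
      ∑ i ∈ (univ : Finset (Fin (d + 1))).erase μ, ∑ j ∈ (univ : Finset (Fin (d + 1))).erase μ,
        if i < j then (ofLex x i : ℕ) * (ofLex x j : ℕ) else 0 := by
  unfold quadForm
  rw [← Finset.add_sum_erase _ _ (Finset.mem_univ μ)]
  conv_lhs => arg 2; arg 2; ext i; rw [← Finset.add_sum_erase _ _ (Finset.mem_univ μ)]
  rw [Finset.sum_add_distrib, ← add_assoc]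
  congr 1
  -- the terms containing `x_μ`: `Σ_j [μ<j] x_μ x_j + Σ_i [i<μ] x_i x_μ = x_μ Σ_{j≠μ} x_j`
  rw [← Finset.add_sum_erase _ _ (Finset.mem_univ μ), if_neg (lt_irrefl _), zero_add, Finset.mul_sum,
    ← Finset.sum_add_distrib]
  refine Finset.sum_congr rfl fun j hj => ?_
  have hne : j ≠ μ := Finset.ne_of_mem_erase hj
  rcases lt_or_gt_of_ne hne with h | h
  · rw [if_neg (not_lt.2 h.le), if_pos h, zero_add, mul_comm]
  · rw [if_pos h, if_neg (not_lt.2 h.le), add_zero]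

/-- `(-1)^{q(x + e_μ)} = (-1)^{Σ_{j≠μ} x_j} (-1)^{q(x)}`. [cite: Koma2022, (4.8)–(4.9)] -/
theorem neg_one_pow_quadForm_shift (hL : Even L) (x : FermionTorus (d + 1) L) (μ : Fin (d + 1)) :
    (-1 : ℝ) ^ quadForm (shift x μ) =
      (-1) ^ (∑ j ∈ (univ : Finset (Fin (d + 1))).erase μ, (ofLex x j : ℕ)) * (-1) ^ quadForm x := by
  have hrest : ∀ j ∈ (univ : Finset (Fin (d + 1))).erase μ, (ofLex (shift x μ) j : ℕ) = (ofLex x j : ℕ) := by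
    intro j hj
    rw [ofLex_shift, Function.update_of_ne (Finset.ne_of_mem_erase hj)]
  rw [quadForm_eq (shift x μ) μ, quadForm_eq x μ, Finset.sum_congr rfl hrest,
    Finset.sum_congr rfl (fun i hi => Finset.sum_congr rfl (fun j hj => by rw [hrest i hi, hrest j hj])),
    pow_add, pow_add, ← mul_assoc]
  congr 1
  rw [ofLex_shift, Function.update_self, pow_mul, pow_mul, neg_one_pow_val_add_one hL, neg_pow, ← pow_mul]

/-! #### The seam gauge along a bond -/

omit [NeZero L] in
/-- `ω(c+1) = (-1)^c w(c) ω(c)` for `c + 1 < L`: `w(c) = +1` for `c < L/2`, `-1` otherwise.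
[cite: Koma2022, §4.1 (4.1)] -/
theorem omega1_succ (hL : Even L) {c : ℕ} (hc : c + 1 < L) :
    omega1 L (c + 1) = (-1) ^ c * (if c < L / 2 then 1 else -1) * omega1 L c := by
  obtain ⟨k, hk⟩ := hL
  have hk2 : L / 2 = k := by omega
  unfold omega1
  rw [hk2]
  have htri : (c + 1) * (c + 1 - 1) / 2 = c * (c - 1) / 2 + c := by
    rcases Nat.even_or_odd c with ⟨m, hm⟩ | ⟨m, hm⟩
    · subst hm; 
      rw [show m + m + 1 - 1 = m + m by omega, show (m + m + 1) * (m + m) = 2 * (m * (2 * m + 1)) by ring,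
        Nat.mul_div_cancel_left _ (by norm_num)]
      rcases Nat.eq_zero_or_pos m with rfl | hm0
      · simp
      · rw [show m + m - 1 = 2 * m - 1 by omega,
          show (m + m) * (2 * m - 1) = 2 * (m * (2 * m - 1)) by ring, Nat.mul_div_cancel_left _ (by norm_num)]
        have : m * (2 * m - 1) + (m + m) = m * (2 * m + 1) := by
          zify [show 1 ≤ 2 * m by omega]; ring
        omega
    · subst hm
      rw [show 2 * m + 1 + 1 - 1 = 2 * m + 1 by omega, show 2 * m + 1 - 1 = 2 * m by omega,
        show (2 * m + 1 + 1) * (2 * m + 1) = 2 * ((m + 1) * (2 * m + 1)) by ring,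
        show (2 * m + 1) * (2 * m) = 2 * (m * (2 * m + 1)) by ring,
        Nat.mul_div_cancel_left _ (by norm_num), Nat.mul_div_cancel_left _ (by norm_num)]
      ring
  rw [htri]
  by_cases hlt : c < k
  · rw [if_pos hlt, show c + 1 - k = 0 by omega, show c - k = 0 by omega, mul_one, add_zero, add_zero,
      pow_add, mul_comm]
  · rw [if_neg hlt, show c + 1 - k = (c - k) + 1 by omega, pow_add, pow_add, pow_add, pow_one]
    ring

omit [NeZero L] in
/-- The seam gauge closes up around the torus: `ω(L - 1) = 1` (`= ω(0)`, consistent with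
`ω(L-1)ω(0) = (-1)^{L-1} w(L-1) = 1`). [cite: Koma2022, §4.1 (4.1)] -/
theorem omega1_last (hL : Even L) (h2 : 2 ≤ L) : omega1 L (L - 1) = 1 := by
  obtain ⟨k, hk⟩ := hL
  obtain ⟨k', rfl⟩ : ∃ k', k = k' + 1 := ⟨k - 1, by omega⟩
  unfold omega1
  apply Even.neg_one_pow
  have e1 : L - 1 - 1 = 2 * k' := by omega
  have e2 : L - 1 - L / 2 = k' := by omega
  have e3 : (L - 1) * (2 * k') / 2 = (L - 1) * k' := by
    rw [show (L - 1) * (2 * k') = 2 * ((L - 1) * k') by ring, Nat.mul_div_cancel_left _ (by norm_num)]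
  rw [e1, e3, e2, show (L - 1) * k' + k' = ((L - 1) + 1) * k' by ring, show L - 1 + 1 = L by omega, hk]
  exact ⟨(k' + 1) * k', by ring⟩

omit [NeZero L] in
/-- `ω(0) = 1`. [cite: Koma2022, §4.1] -/
theorem omega1_zero : omega1 L 0 = 1 := by
  unfold omega1; simp

omit [NeZero L] in
/-- `ω(c)² = 1`. [cite: Koma2022, §4.1] -/
theorem omega1_sq (c : ℕ) : omega1 L c * omega1 L c = 1 := by
  unfold omega1
  rw [← pow_add, ← two_mul, pow_mul, neg_one_sq, one_pow]

/-- **The gauge along a bond**: `φ(x) φ(x + e_μ) = (-1)^x · w(x_μ)`, `w = +1` below the plane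
`x_μ = L/2`, `-1` from it on (including the boundary bond). [cite: Koma2022, §4.1 (4.1), §4.2 (4.8)–(4.9)] -/
theorem komaGauge_mul_shift (hL : Even L) (h2 : 2 ≤ L) (x : FermionTorus (d + 1) L) (μ : Fin (d + 1)) :
    komaGauge x * komaGauge (shift x μ) =
      stagSign x * (if (ofLex x μ : ℕ) < L / 2 then 1 else -1) := by
  have hR := neg_one_pow_quadForm_shift hL x μ
  -- `ω(x_μ) ω(x_μ + 1 mod L) = (-1)^{x_μ} w(x_μ)`
  have hω : omega1 L (ofLex x μ : ℕ) * omega1 L (ofLex (shift x μ) μ : ℕ) =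
      (-1) ^ (ofLex x μ : ℕ) * (if (ofLex x μ : ℕ) < L / 2 then 1 else -1) := by
    rw [ofLex_shift, Function.update_self, Fin.val_add, Fin.val_one', Nat.add_mod_mod]
    by_cases hlt : (ofLex x μ : ℕ) + 1 < L
    · rw [Nat.mod_eq_of_lt hlt, omega1_succ hL hlt]
      have hsq := omega1_sq (L := L) (ofLex x μ : ℕ)
      linear_combination ((-1 : ℝ) ^ (ofLex x μ : ℕ) * (if (ofLex x μ : ℕ) < L / 2 then (1 : ℝ) else -1)) * hsq
    · have heq : (ofLex x μ : ℕ) + 1 = L := by have := (ofLex x μ).isLt; omega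
      obtain ⟨k, hk⟩ := hL
      rw [heq, Nat.mod_self, omega1_zero, mul_one, show (ofLex x μ : ℕ) = L - 1 by omega,
        omega1_last ⟨k, hk⟩ h2, if_neg (by omega), Odd.neg_one_pow ⟨k - 1, by omega⟩]
      norm_num
  -- the `ω`'s of the other directions square to `1`
  have hP : (∏ ν : Fin (d + 1), omega1 L (ofLex x ν : ℕ)) * ∏ ν : Fin (d + 1), omega1 L (ofLex (shift x μ) ν : ℕ) =
      (-1) ^ (ofLex x μ : ℕ) * (if (ofLex x μ : ℕ) < L / 2 then 1 else -1) := by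
    rw [← Finset.prod_mul_distrib, ← Finset.mul_prod_erase _ _ (Finset.mem_univ μ), hω,
      Finset.prod_eq_one, mul_one]
    intro ν hν
    rw [ofLex_shift, Function.update_of_ne (Finset.ne_of_mem_erase hν), omega1_sq]
  have hq : ((-1 : ℝ) ^ quadForm x) * (-1) ^ quadForm x = 1 := by
    rw [← pow_add, ← two_mul, pow_mul, neg_one_sq, one_pow]
  have hε : stagSign x = (-1) ^ (ofLex x μ : ℕ) * (-1) ^ (∑ j ∈ (univ : Finset (Fin (d + 1))).erase μ, (ofLex x j : ℕ)) := by
    rw [stagSign, siteParity, ← Finset.add_sum_erase _ _ (Finset.mem_univ μ), pow_add]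
  unfold komaGauge
  calc (-1) ^ quadForm x * (∏ ν : Fin (d + 1), omega1 L (ofLex x ν : ℕ)) *
        ((-1) ^ quadForm (shift x μ) * ∏ ν : Fin (d + 1), omega1 L (ofLex (shift x μ) ν : ℕ))
      = ((-1) ^ quadForm x * (-1) ^ quadForm (shift x μ)) *
          ((∏ ν : Fin (d + 1), omega1 L (ofLex x ν : ℕ)) * ∏ ν : Fin (d + 1), omega1 L (ofLex (shift x μ) ν : ℕ)) := by
        ring
    _ = stagSign x * (if (ofLex x μ : ℕ) < L / 2 then 1 else -1) := by
        rw [hP, hR, hε]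
        linear_combination ((-1 : ℝ) ^ (∑ j ∈ (univ : Finset (Fin (d + 1))).erase μ, (ofLex x j : ℕ)) *
          (-1) ^ (ofLex x μ : ℕ) * (if (ofLex x μ : ℕ) < L / 2 then (1 : ℝ) else -1)) * hq

omit [NeZero L] in
/-- `w(c) u(c) = seam(c)`: the Lieb-frame layer sign times the half-space sign is the
antiperiodic seam sign. [cite: Koma2022, §4.1] [cite: Lieb1994, p. 3] -/
theorem halfSign_mul_axialSign (hL : Even L) (x : FermionTorus (d + 1) L) (μ : Fin (d + 1)) :
    (if (ofLex x μ : ℕ) < L / 2 then (1 : ℝ) else -1) * axialSign L (ofLex x μ : ℕ) = seamSign x μ := by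
  have hlt := (ofLex x μ).isLt
  obtain ⟨k, hk⟩ := hL
  unfold axialSign seamSign
  by_cases h1 : (ofLex x μ : ℕ) < L / 2
  · rw [if_pos h1, if_pos (Or.inl h1), if_neg (by omega), one_mul]
  · by_cases h2 : (ofLex x μ : ℕ) + 1 = L
    · rw [if_neg h1, if_pos (Or.inr (by omega)), if_pos h2, mul_one]
    · rw [if_neg h1, if_neg (by omega), if_neg h2, neg_mul_neg, one_mul]

omit [NeZero L] in
/-- `star` of a real number in `ℂ`. [folklore] -/
private theorem star_ofReal' (r : ℝ) : star (r : ℂ) = r := by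
  rw [Complex.star_def, Complex.conj_ofReal]

/-- **`𝒰 K(T_π) 𝒰† = K(T_Koma)` bondwise**: `g(x) g(x+e_μ)^* T_π(x, x+e_μ) = printedAmpl(x, x+e_μ)`.
[cite: Koma2022, (2.8)–(2.9), §4.1–4.2, (5.12)–(5.15)] -/
theorem komaPhase_piFluxAmpl_shift (hL : Even L) (h3 : 3 ≤ L) (κ : ℝ) (σ : Fin 2)
    (x : FermionTorus (d + 1) L) (μ : Fin (d + 1)) :
    komaPhase σ x * star (komaPhase σ (shift x μ)) * piFluxAmpl κ σ x (shift x μ) =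
      printedAmpl κ σ x (shift x μ) := by
  have h2 : 2 ≤ L := by omega
  have hg := komaGauge_mul_shift hL h2 x μ
  have hr := rotPhase_mul_conj_shift hL x μ
  have hreal : stagSign x * (stagSign x * (if (ofLex x μ : ℕ) < L / 2 then (1 : ℝ) else -1)) *
      (κ * ((-1) ^ (∑ k ∈ (univ : Finset (Fin (d + 1))).filter (· < μ), (ofLex x k : ℕ)) *
        axialSign L (ofLex x μ : ℕ))) = κ * stair x μ * seamSign x μ := by
    rw [← halfSign_mul_axialSign hL x μ, stair]
    linear_combination ((if (ofLex x μ : ℕ) < L / 2 then (1 : ℝ) else -1) * κ *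
      (-1 : ℝ) ^ (∑ k ∈ (univ : Finset (Fin (d + 1))).filter (· < μ), (ofLex x k : ℕ)) *
      axialSign L (ofLex x μ : ℕ)) * stagSign_sq x
  rw [piFluxAmpl_shift h3, printedAmpl_shift h3, bondSign_eq, komaPhase, komaPhase, star_mul, star_ofReal']
  calc rotPhase x * (komaGauge x : ℂ) * ((komaGauge (shift x μ) : ℂ) * star (rotPhase (shift x μ))) *
        ((κ * ((-1) ^ (∑ k ∈ (univ : Finset (Fin (d + 1))).filter (· < μ), (ofLex x k : ℕ)) *
          axialSign L (ofLex x μ : ℕ)) : ℝ) : ℂ)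
      = (rotPhase x * star (rotPhase (shift x μ))) *
          (((komaGauge x * komaGauge (shift x μ)) * (κ * ((-1) ^ (∑ k ∈ (univ : Finset (Fin (d + 1))).filter
            (· < μ), (ofLex x k : ℕ)) * axialSign L (ofLex x μ : ℕ))) : ℝ) : ℂ) := by
        push_cast; ring
    _ = -Complex.I * ((κ * stair x μ * seamSign x μ : ℝ) : ℂ) := by
        rw [hr, hg, ← hreal]
        push_cast; ring

/-- **`𝒰 K(T_π(κ)) 𝒰† = K(printedAmpl κ)`** on every bond: the gauged Lieb-frame amplitudes are
Koma's printed amplitudes. [cite: Koma2022, (2.7)–(2.9), §4] -/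
theorem komaPhase_piFluxAmpl (hL : Even L) (h3 : 3 ≤ L) (κ : ℝ) (σ : Fin 2) {x y : FermionTorus (d + 1) L}
    (hxy : (G d L).Adj x y) :
    komaPhase σ x * star (komaPhase σ y) * piFluxAmpl κ σ x y = printedAmpl κ σ x y := by
  have h2 : 2 ≤ L := by omega
  rcases (adj_iff_shift_or_unshift h2 x y).1 hxy with ⟨μ, rfl⟩ | ⟨μ, rfl⟩
  · exact komaPhase_piFluxAmpl_shift hL h3 κ σ x μ
  · -- the reversed bond: conjugate the forward identity at `y = x - e_μ`
    have h := congrArg star (komaPhase_piFluxAmpl_shift hL h3 κ σ (unshift x μ) μ)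
    rw [shift_unshift, star_mul, star_mul, star_star, ← piFluxAmpl_herm, ← printedAmpl_herm] at h
    rw [← h]
    ring

end Gauge

/-! ### `[Γ¹_x]² = [Γ²_x]² = 2(n_{x↑} - ½)(n_{x↓} - ½) + ½` -/

section OnSite

variable {Λ : Type*} [LinearOrder Λ] [Fintype Λ]

/-- `Γ⁺_x Γ⁻_x = n_{x↑} n_{x↓}`. [cite: Koma2022, (3.7)] -/
theorem gammaPlus_mul_gammaMinus (x : Λ) : gammaPlus x * gammaMinus x = numberOp x 0 * numberOp x 1 := by
  have hne : orb x (0 : Fin 2) ≠ orb x 1 := fun h => absurd (orb_eq_orb_iff.1 h).2 (by decide)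
  have h1 : annihilation (orb x (0 : Fin 2)) * creation (orb x 1) =
      -(creation (orb x 1) * annihilation (orb x (0 : Fin 2))) := by
    rw [annihilation_mul_creation, if_neg hne, zero_sub]
  have h2 : annihilation (orb x (0 : Fin 2)) * annihilation (orb x 1) =
      -(annihilation (orb x 1) * annihilation (orb x (0 : Fin 2))) :=
    eq_neg_of_add_eq_zero_left (annihilation_anticommute_holds (orb x (0 : Fin 2)) (orb x 1))
  symm
  unfold numberOp gammaPlus gammaMinus
  calc creation (orb x 0) * annihilation (orb x 0) * (creation (orb x 1) * annihilation (orb x 1))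
      = creation (orb x 0) * (annihilation (orb x 0) * creation (orb x 1)) * annihilation (orb x 1) := by
        simp only [Matrix.mul_assoc]
    _ = -(creation (orb x 0) * creation (orb x 1) * (annihilation (orb x 0) * annihilation (orb x 1))) := by
        rw [h1]; simp only [Matrix.mul_neg, Matrix.neg_mul, Matrix.mul_assoc]
    _ = creation (orb x 0) * creation (orb x 1) * (annihilation (orb x 1) * annihilation (orb x 0)) := by
        rw [h2, Matrix.mul_neg, neg_neg]

/-- `Γ⁻_x Γ⁺_x = (1 - n_{x↑})(1 - n_{x↓})`. [cite: Koma2022, (3.7)] -/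
theorem gammaMinus_mul_gammaPlus (x : Λ) :
    gammaMinus x * gammaPlus x = (1 - numberOp x 0) * (1 - numberOp x 1) := by
  have hne : orb x (1 : Fin 2) ≠ orb x 0 := fun h => absurd (orb_eq_orb_iff.1 h).2 (by decide)
  -- `c_1 c_0 c†_0 c†_1 = c_1 (1 - n_0) c†_1 = (1 - n_1) - n_0 (1 - n_1)`
  have hc0 : annihilation (orb x (0 : Fin 2)) * creation (orb x 0) = 1 - numberOp x 0 := by
    rw [annihilation_mul_creation, if_pos rfl, numberOp]
  have hc1 : annihilation (orb x (1 : Fin 2)) * creation (orb x 1) = 1 - numberOp x 1 := by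
    rw [annihilation_mul_creation, if_pos rfl, numberOp]
  -- `n_0` commutes with `c_1`
  have hn0a : annihilation (orb x (1 : Fin 2)) * numberOp x 0 = numberOp x 0 * annihilation (orb x 1) := by
    have h10 : annihilation (orb x (1 : Fin 2)) * creation (orb x 0) =
        -(creation (orb x 0) * annihilation (orb x (1 : Fin 2))) := by
      rw [annihilation_mul_creation, if_neg hne, zero_sub]
    have h10' : annihilation (orb x (1 : Fin 2)) * annihilation (orb x 0) =
        -(annihilation (orb x 0) * annihilation (orb x (1 : Fin 2))) :=
      eq_neg_of_add_eq_zero_left (annihilation_anticommute_holds (orb x (1 : Fin 2)) (orb x 0))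
    unfold numberOp
    rw [← Matrix.mul_assoc, h10, Matrix.neg_mul, Matrix.mul_assoc, h10', Matrix.mul_neg, neg_neg,
      Matrix.mul_assoc]
  unfold gammaMinus gammaPlus
  calc annihilation (orb x 1) * annihilation (orb x 0) * (creation (orb x 0) * creation (orb x 1))
      = annihilation (orb x 1) * (annihilation (orb x 0) * creation (orb x 0)) * creation (orb x 1) := by
        simp only [Matrix.mul_assoc]
    _ = annihilation (orb x 1) * creation (orb x 1) -
          annihilation (orb x 1) * numberOp x 0 * creation (orb x 1) := by
        rw [hc0, Matrix.mul_sub, Matrix.mul_one, Matrix.sub_mul]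
    _ = (1 - numberOp x 1) - numberOp x 0 * (1 - numberOp x 1) := by
        rw [hc1, hn0a, Matrix.mul_assoc, hc1]
    _ = (1 - numberOp x 0) * (1 - numberOp x 1) := by noncomm_ring

/-- **Koma's (3.7)**: `[Γ¹_x]² = 2 n_{x↑}n_{x↓} - n_{x↑} - n_{x↓} + 1`. [cite: Koma2022, (3.7)] -/
theorem gammaOne_mul_self_eq (x : Λ) :
    gammaOne x * gammaOne x = 2 • (numberOp x 0 * numberOp x 1) - numberOp x 0 - numberOp x 1 + 1 := by
  rw [gammaOne_mul_self, gammaPlus_mul_gammaMinus, gammaMinus_mul_gammaPlus]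
  noncomm_ring

/-- The same in the form of the tree's Hubbard interaction:
`[Γ¹_x]² = 2(n_{x↑} - ½)(n_{x↓} - ½) + ½`. [cite: Koma2022, (3.7)] -/
theorem gammaOne_mul_self_eq' (x : Λ) :
    gammaOne x * gammaOne x =
      (2 : ℂ) • ((numberOp x 0 - (1 / 2 : ℂ) • 1) * (numberOp x 1 - (1 / 2 : ℂ) • 1)) +
        (1 / 2 : ℂ) • (1 : Matrix (Finset (Orb Λ)) (Finset (Orb Λ)) ℂ) := by
  rw [gammaOne_mul_self_eq]
  simp only [Matrix.sub_mul, Matrix.mul_sub, Matrix.smul_mul, Matrix.mul_smul, Matrix.one_mul, Matrix.mul_one,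
    smul_sub, smul_smul]
  module

end OnSite

/-! ### The conjugation theorem -/

section Conjugation

/-- `(A + B)² + (A - B)² = 2A² + 2B²` (no commutativity needed). [folklore] -/
private theorem sq_add_add_sq_sub {k : Type*} [Fintype k] [DecidableEq k] (A B : Matrix k k ℂ) :
    (A + B) * (A + B) + (A - B) * (A - B) = (2 : ℂ) • (A * A) + (2 : ℂ) • (B * B) := by
  rw [Matrix.add_mul, Matrix.mul_add, Matrix.mul_add, Matrix.sub_mul, Matrix.mul_sub, Matrix.mul_sub, two_smul,
    two_smul]
  abel

omit [NeZero L] in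
/-- The gauged bond term: `[εΓ¹_x - (-ε)Γ¹_y + φ]² + [εΓ²_x - (-ε)Γ²_y]² = [Γ¹_x + Γ¹_y + εφ]² + [Γ²_x + Γ²_y]²`
for `ε = ±1`. [cite: Koma2022, (3.5) vs (6.6) (the rotated frame)] -/
theorem bondTerm_stag (g φ ε : ℝ) (hε : ε * ε = 1) (x y : FermionTorus (d + 1) L) :
    ((g / 8 : ℝ) : ℂ) • (((ε : ℂ) • gammaOne x - ((-ε : ℝ) : ℂ) • gammaOne y + (φ : ℂ) • 1) *
        ((ε : ℂ) • gammaOne x - ((-ε : ℝ) : ℂ) • gammaOne y + (φ : ℂ) • 1) +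
      ((ε : ℂ) • gammaTwo x - ((-ε : ℝ) : ℂ) • gammaTwo y) * ((ε : ℂ) • gammaTwo x - ((-ε : ℝ) : ℂ) • gammaTwo y)) =
    ((g / 8 : ℝ) : ℂ) • ((gammaOne x + gammaOne y + ((ε * φ : ℝ) : ℂ) • 1) *
        (gammaOne x + gammaOne y + ((ε * φ : ℝ) : ℂ) • 1) +
      (gammaTwo x + gammaTwo y) * (gammaTwo x + gammaTwo y)) := by
  have hε' : (ε : ℂ) * (ε : ℂ) = 1 := by rw [← Complex.ofReal_mul, hε, Complex.ofReal_one]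
  congr 1
  have h1 : (ε : ℂ) • gammaOne x - ((-ε : ℝ) : ℂ) • gammaOne y + (φ : ℂ) • (1 : Matrix _ _ ℂ) =
      (ε : ℂ) • (gammaOne x + gammaOne y + ((ε * φ : ℝ) : ℂ) • 1) := by
    rw [smul_add, smul_add, smul_smul, Complex.ofReal_mul, ← mul_assoc, hε', one_mul, Complex.ofReal_neg,
      neg_smul, sub_neg_eq_add]
  have h2 : (ε : ℂ) • gammaTwo x - ((-ε : ℝ) : ℂ) • gammaTwo y = (ε : ℂ) • (gammaTwo x + gammaTwo y) := by
    rw [smul_add, Complex.ofReal_neg, neg_smul, sub_neg_eq_add]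
  rw [h1, h2, Matrix.smul_mul, Matrix.mul_smul, smul_smul, hε', one_smul, Matrix.smul_mul, Matrix.mul_smul,
    smul_smul, hε', one_smul]

/-- `peierlsHubbard G T U = peierlsHubbard G T 0 + U Σ_x (n_{x↑} - ½)(n_{x↓} - ½)`. [cite: Koma2022, (2.4), (2.6)] -/
theorem peierlsHubbard_eq_add_U {Λ : Type*} [LinearOrder Λ] [Fintype Λ] (G : SimpleGraph Λ) [DecidableRel G.Adj]
    (T : Fin 2 → Λ → Λ → ℂ) (U : ℝ) :
    peierlsHubbard G T U = peierlsHubbard G T 0 +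
      (U : ℂ) • ∑ x : Λ, (numberOp x 0 - (1 / 2 : ℂ) • 1) * (numberOp x 1 - (1 / 2 : ℂ) • 1) := by
  rw [peierlsHubbard_def, peierlsHubbard_def, Complex.ofReal_zero, zero_smul, add_zero]

/-- The gauged bond term on the bond `(x, y)`:
`(g/8){[Γ¹_x + Γ¹_y + (-1)^x h(x,y)]² + [Γ²_x + Γ²_y]²}`. [cite: Koma2022, (3.5)] -/
def gaugedBond (g : ℝ) (h : Fin (d + 1) → FermionTorus (d + 1) L → ℝ) (x y : FermionTorus (d + 1) L) :
    Matrix (Finset (Orb (FermionTorus (d + 1) L))) (Finset (Orb (FermionTorus (d + 1) L))) ℂ :=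
  ((g / 8 : ℝ) : ℂ) • ((gammaOne x + gammaOne y + ((stagSign x * bondField h x y : ℝ) : ℂ) • 1) *
      (gammaOne x + gammaOne y + ((stagSign x * bondField h x y : ℝ) : ℂ) • 1) +
    (gammaTwo x + gammaTwo y) * (gammaTwo x + gammaTwo y))

/-- The gauged bond term on `(x, x + e_μ)`, in Koma's variables. [cite: Koma2022, (3.5)] -/
theorem gaugedBond_shift (h3 : 3 ≤ L) (g : ℝ) (h : Fin (d + 1) → FermionTorus (d + 1) L → ℝ)
    (x : FermionTorus (d + 1) L) (μ : Fin (d + 1)) :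
    gaugedBond g h x (shift x μ) =
      ((g / 8 : ℝ) : ℂ) • ((gammaOne x + gammaOne (shift x μ) + ((stagSign x * h μ x : ℝ) : ℂ) • 1) *
          (gammaOne x + gammaOne (shift x μ) + ((stagSign x * h μ x : ℝ) : ℂ) • 1) +
        (gammaTwo x + gammaTwo (shift x μ)) * (gammaTwo x + gammaTwo (shift x μ))) := by
  rw [gaugedBond, bondField_shift h3]

/-- Both orientations of a bond carry the same gauged term. [cite: Koma2022, (3.5), (5.93)/(5.96)] -/
theorem gaugedBond_shift' (hL : Even L) (h3 : 3 ≤ L) (g : ℝ) (h : Fin (d + 1) → FermionTorus (d + 1) L → ℝ)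
    (x : FermionTorus (d + 1) L) (μ : Fin (d + 1)) :
    gaugedBond g h (shift x μ) x = gaugedBond g h x (shift x μ) := by
  rw [gaugedBond, gaugedBond, bondField_shift h3, bondField_shift' h3, stagSign_shift hL, neg_mul_neg,
    add_comm (gammaOne (shift x μ)) (gammaOne x), add_comm (gammaTwo (shift x μ)) (gammaTwo x)]

variable (hL : Even L) (h4 : 4 ≤ L)
include hL h4

/-- **`𝒰 H_pair(g, bondField h) 𝒰† = H_int(h) + (Dg/2) Σ_x ([Γ¹_x]² + [Γ²_x]²)`** — the gauged
Lieb-frame pair interaction is Koma's (3.5) plus on-site squares. [cite: Koma2022, (3.4)–(3.5), (6.6)] -/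
theorem orbitalPhaseAut_pairInteraction_bondField (g : ℝ) (h : Fin (d + 1) → FermionTorus (d + 1) L → ℝ) :
    orbitalPhaseAut (g := spinSitePhase komaPhase) (fun _ => norm_komaPhase _ _)
        (pairInteraction (G d L) g (bondField h)) =
      printedPair g h + (((d + 1 : ℕ) * g / 2 : ℝ) : ℂ) •
        ∑ x : FermionTorus (d + 1) L, (gammaOne x * gammaOne x + gammaTwo x * gammaTwo x) := by
  have h3 : 3 ≤ L := by omega
  have h2 : 2 ≤ L := by omega
  -- gauge each bond term
  have hb : ∀ x y : FermionTorus (d + 1) L, (G d L).Adj x y →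
      orbitalPhaseAut (g := spinSitePhase komaPhase) (fun _ => norm_komaPhase _ _)
        (bondTerm g (bondField h x y) x y) = gaugedBond g h x y := by
    intro x y hxy
    have hy : stagSign y = -stagSign x := by
      rcases (adj_iff_shift_or_unshift h2 x y).1 hxy with ⟨μ, rfl⟩ | ⟨μ, rfl⟩
      · exact stagSign_shift hL x μ
      · have h := stagSign_shift hL (unshift x μ) μ
        rw [shift_unshift] at h
        linarith
    rw [bondTerm, map_smul, map_add, map_mul, map_mul, map_add, map_sub, map_sub, map_smul, map_one,
      komaPhase_gammaOne, komaPhase_gammaOne, komaPhase_gammaTwo, komaPhase_gammaTwo, hy, gaugedBond]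
    exact bondTerm_stag g (bondField h x y) (stagSign x) (stagSign_sq x) x y
  -- (1) sum over ordered adjacent pairs = `Σ_x Σ_μ 2 •` the term of the bond `(x, x + e_μ)`
  have hite : ∀ x y : FermionTorus (d + 1) L,
      orbitalPhaseAut (g := spinSitePhase komaPhase) (fun _ => norm_komaPhase _ _)
          (if (G d L).Adj x y then bondTerm g (bondField h x y) x y else 0) =
        if (G d L).Adj x y then gaugedBond g h x y else 0 := by
    intro x y
    split_ifs with hxy
    · exact hb x y hxy
    · exact map_zero _
  have hstep1 : orbitalPhaseAut (g := spinSitePhase komaPhase) (fun _ => norm_komaPhase _ _)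
      (pairInteraction (G d L) g (bondField h)) =
      ∑ x : FermionTorus (d + 1) L, ∑ μ : Fin (d + 1), (2 : ℂ) • gaugedBond g h x (shift x μ) := by
    rw [pairInteraction, map_sum]
    simp only [map_sum, hite]
    rw [← sum_shift_add_sum_shift_swap h3]
    refine Finset.sum_congr rfl fun x _ => Finset.sum_congr rfl fun μ _ => ?_
    rw [gaugedBond_shift' hL h3, two_smul]
  -- (2) the `Γ²` squares: `[Γ²_x + Γ²_y]² + [Γ²_x - Γ²_y]² = 2[Γ²_x]² + 2[Γ²_y]²`, summed
  have hstep2 : ∑ x : FermionTorus (d + 1) L, ∑ μ : Fin (d + 1),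
      (gammaTwo x + gammaTwo (shift x μ)) * (gammaTwo x + gammaTwo (shift x μ)) =
      (4 * (d + 1 : ℕ) : ℂ) • (∑ x : FermionTorus (d + 1) L, gammaTwo x * gammaTwo x) -
        ∑ x : FermionTorus (d + 1) L, ∑ μ : Fin (d + 1),
          (gammaTwo x - gammaTwo (shift x μ)) * (gammaTwo x - gammaTwo (shift x μ)) := by
    rw [eq_sub_iff_add_eq, ← Finset.sum_add_distrib]
    simp only [← Finset.sum_add_distrib, sq_add_add_sq_sub]
    rw [Finset.sum_comm]
    have hμ : ∀ μ : Fin (d + 1), ∑ x : FermionTorus (d + 1) L,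
        ((2 : ℂ) • (gammaTwo x * gammaTwo x) + (2 : ℂ) • (gammaTwo (shift x μ) * gammaTwo (shift x μ))) =
        (4 : ℂ) • ∑ x : FermionTorus (d + 1) L, gammaTwo x * gammaTwo x := by
      intro μ
      have e := Equiv.sum_comp (shiftEquiv (L := L) μ) (fun y => gammaTwo y * gammaTwo y)
      simp only [shiftEquiv_apply] at e
      rw [Finset.sum_add_distrib, ← Finset.smul_sum, ← Finset.smul_sum, e, ← add_smul]
      norm_num
    simp only [hμ, Finset.sum_const, Finset.card_univ, Fintype.card_fin]
    rw [← Nat.cast_smul_eq_nsmul ℂ, smul_smul]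
    congr 1
    push_cast
    ring
  -- (3) `[Γ¹]² = [Γ²]²` summed
  have hstep3 : ∑ x : FermionTorus (d + 1) L, gammaOne x * gammaOne x =
      ∑ x : FermionTorus (d + 1) L, gammaTwo x * gammaTwo x :=
    Finset.sum_congr rfl fun x _ => gammaOne_sq_eq_gammaTwo_sq x
  -- assemble
  rw [hstep1]
  simp only [gaugedBond_shift h3, smul_add, smul_smul, Finset.sum_add_distrib, ← Finset.smul_sum]
  rw [hstep2, printedPair, Finset.sum_sub_distrib, hstep3]
  push_cast
  module

omit [NeZero L] hL h4 in
/-- `𝒰 O_Lieb 𝒰† = O`: the uniform order parameter of Lieb's frame becomes Koma's staggered (2.5).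
[cite: Koma2022, (2.5), (3.3), (6.5)] -/
theorem orbitalPhaseAut_orderParameter_eq_printed :
    orbitalPhaseAut (g := spinSitePhase komaPhase) (fun _ => norm_komaPhase _ _)
        (orderParameter : Matrix (Finset (Orb (FermionTorus (d + 1) L))) _ ℂ) = printedOrder := by
  rw [orderParameter, printedOrder, map_sum]
  exact Finset.sum_congr rfl fun x _ => komaPhase_gammaTwo x

/-- **The identification.** Conjugation by `𝒰 = e^{(iπ/2)Σ_{x odd} n_x} ∏_x φ(x)^{n_x}` maps the
Lieb-frame model with `U = -2Dg` (`D = d + 1` the number of directions) onto Koma's printed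
Hamiltonian (3.6) up to the additive constant `Dg|Λ|/2`:
`𝒰 · H_Lieb(T_π(κ), U = -2Dg; g, bondField h; B) · 𝒰† = H(B, h) + (Dg|Λ|/2)·1`.
[cite: Koma2022, (2.4)–(2.9), (3.5)–(3.8), §4.1–4.2, (6.5)] -/
theorem orbitalPhaseAut_hamiltonian_eq_printed (κ g : ℝ) (h : Fin (d + 1) → FermionTorus (d + 1) L → ℝ)
    (B : ℝ) :
    orbitalPhaseAut (g := spinSitePhase komaPhase) (fun _ => norm_komaPhase _ _)
        (hamiltonian κ (-2 * (d + 1 : ℕ) * g) g (bondField h) B) =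
      printedHamiltonian κ g h B +
        (((d + 1 : ℕ) * g * Fintype.card (FermionTorus (d + 1) L) / 2 : ℝ) : ℂ) • 1 := by
  have h3 : 3 ≤ L := by omega
  rw [hamiltonian, PairHopRP.hamiltonian, map_sub, map_add, map_smul,
    orbitalPhaseAut_peierlsHubbard (G d L) komaPhase norm_komaPhase (piFluxAmpl κ),
    peierlsHubbard_congr (G d L) (fun σ x y hxy => komaPhase_piFluxAmpl hL h3 κ σ hxy),
    orbitalPhaseAut_pairInteraction_bondField hL h4, orbitalPhaseAut_orderParameter_eq_printed,
    printedHamiltonian, peierlsHubbard_eq_add_U (G d L) (printedAmpl κ) (-2 * (d + 1 : ℕ) * g)]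
  simp only [gammaOne_sq_eq_gammaTwo_sq]
  -- `U Σ(n-½)(n-½) + (Dg/2)Σ 2[Γ²]² = Dg|Λ|/2` with `U = -2Dg`, `[Γ²]² = 2(n-½)(n-½) + ½`
  have hsite : ∀ x : FermionTorus (d + 1) L, gammaTwo x * gammaTwo x + gammaTwo x * gammaTwo x =
      (4 : ℂ) • ((numberOp x 0 - (1 / 2 : ℂ) • 1) * (numberOp x 1 - (1 / 2 : ℂ) • 1)) + (1 : Matrix _ _ ℂ) := by
    intro x
    rw [← gammaOne_sq_eq_gammaTwo_sq, gammaOne_mul_self_eq']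
    module
  simp only [hsite, Finset.sum_add_distrib, ← Finset.smul_sum, Finset.sum_const, Finset.card_univ]
  rw [← Nat.cast_smul_eq_nsmul ℂ (Fintype.card (FermionTorus (d + 1) L)) (1 : Matrix _ _ ℂ)]
  push_cast
  module

omit hL h4 in
/-- `Z(H + r·1) = e^{-βr} Z(H)` (plumbing). [folklore] -/
private theorem partitionFn_add_smul_one' {n : Type*} [Fintype n] [DecidableEq n] (β : ℝ) (H : Matrix n n ℂ)
    (r : ℝ) : partitionFn β (H + (r : ℂ) • 1) = (Real.exp (-(β * r)) : ℂ) * partitionFn β H := by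
  have h := partitionFn_sub_smul_add_smul_one β H 0 0 r
  simp only [smul_zero, sub_zero, add_zero] at h
  exact h

/-- **The partition functions agree up to the constant**:
`Tr e^{-βH(B,h)} = e^{βDg|Λ|/2} · Z_β(T_π(κ), U = -2Dg; g, bondField h; B)`.
[cite: Koma2022, (2.10), (3.6)] -/
theorem partitionFn_printed (κ g : ℝ) (h : Fin (d + 1) → FermionTorus (d + 1) L → ℝ) (B β : ℝ) :
    (printedHamiltonian κ g h B).partitionFn β =
      (Real.exp (β * ((d + 1 : ℕ) * g * Fintype.card (FermionTorus (d + 1) L) / 2)) : ℂ) *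
        (hamiltonian κ (-2 * (d + 1 : ℕ) * g) g (bondField h) B).partitionFn β := by
  have key := orbitalPhaseAut_hamiltonian_eq_printed hL h4 κ g h B
  rw [orbitalPhaseAut_apply, ← star_eq_conjTranspose] at key
  have hZ := partitionFn_unitary_conj
    (orbitalPhase_mem_unitary (g := spinSitePhase (komaPhase (d := d) (L := L))) fun _ => norm_komaPhase _ _) β
    (hamiltonian κ (-2 * (d + 1 : ℕ) * g) g (bondField h) B)
  rw [key, partitionFn_add_smul_one'] at hZ
  rw [← hZ, ← mul_assoc, ← Complex.ofReal_mul, ← Real.exp_add, add_neg_cancel, Real.exp_zero,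
    Complex.ofReal_one, one_mul]

omit [NeZero L] hL h4 in
/-- `stagSign x = ±1`. [cite: Koma2022, (2.5)] -/
theorem stagSign_eq_or (x : FermionTorus (d + 1) L) : stagSign x = 1 ∨ stagSign x = -1 :=
  neg_one_pow_eq_or ℝ _

omit hL h4 in
/-- `T_π(-κ) = -T_π(κ)`. [cite: Koma2022, (2.7)] -/
theorem piFluxAmpl_neg (κ : ℝ) (σ : Fin 2) (x y : FermionTorus (d + 1) L) :
    piFluxAmpl (-κ) σ x y = -piFluxAmpl κ σ x y := by
  unfold piFluxAmpl
  rw [neg_mul, Complex.ofReal_neg]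

omit hL h4 in
/-- `T_π` vanishes off the bonds. [cite: Koma2022, (2.7)] -/
theorem piFluxAmpl_of_not_adj (h2 : 2 ≤ L) (κ : ℝ) (σ : Fin 2) {x y : FermionTorus (d + 1) L}
    (hxy : ¬(G d L).Adj x y) : piFluxAmpl κ σ x y = 0 := by
  unfold piFluxAmpl
  rw [Finset.sum_eq_zero, mul_zero, Complex.ofReal_zero]
  intro μ _
  rw [if_neg, if_neg, add_zero]
  · intro h
    exact hxy (by rw [h]; exact (FermionTorus.adj_shift h2 y μ).symm)
  · intro h
    exact hxy (by rw [h]; exact FermionTorus.adj_shift h2 x μ)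

omit h4 in
/-- **The sign of `κ` is a gauge**: `Z_β(T_π(-κ)) = Z_β(T_π(κ))` (the `ℤ₂` gauge `(-1)^x` flips every
bond amplitude and fixes the pair operators). [cite: Koma2022, §4.1] [cite: Lieb1994, p. 3] -/
theorem partitionFn_neg_kappa (h2 : 2 ≤ L) (κ U g : ℝ) (h : FermionTorus (d + 1) L → FermionTorus (d + 1) L → ℝ)
    (B β : ℝ) : (hamiltonian (-κ) U g h B).partitionFn β = (hamiltonian κ U g h B).partitionFn β := by
  have hT : (fun (σ : Fin 2) (x y : FermionTorus (d + 1) L) => ((stagSign x * stagSign y : ℝ) : ℂ) * piFluxAmpl κ σ x y) =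
      piFluxAmpl (-κ) := by
    funext σ x y
    by_cases hxy : (G d L).Adj x y
    · have hy : stagSign y = -stagSign x := by
        rcases (adj_iff_shift_or_unshift h2 x y).1 hxy with ⟨μ, rfl⟩ | ⟨μ, rfl⟩
        · exact stagSign_shift hL x μ
        · have h := stagSign_shift hL (unshift x μ) μ
          rw [shift_unshift] at h
          linarith
      rw [hy, mul_neg, stagSign_sq, piFluxAmpl_neg]
      push_cast
      ring
    · rw [piFluxAmpl_of_not_adj h2 κ σ hxy, piFluxAmpl_of_not_adj h2 (-κ) σ hxy, mul_zero]
  rw [hamiltonian, hamiltonian, ← hT]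
  exact PairHopRP.partitionFn_hamiltonian_signGauge (G d L) stagSign stagSign_eq_or (piFluxAmpl κ) U g h B β

omit hL h4 in
/-- The bond field of `h = 0` vanishes. [cite: Koma2022, (3.5)–(3.6) (`H(B,0) = H(B)`)] -/
theorem bondField_zero :
    bondField (fun (_ : Fin (d + 1)) (_ : FermionTorus (d + 1) L) => (0 : ℝ)) =
      fun (_ _ : FermionTorus (d + 1) L) => (0 : ℝ) := by
  funext x y
  simp [bondField]

/-- **Theorem 5.3 (5.100) for the printed Hamiltonian (3.6), every real `κ`.** On the even torus
of side `L ≥ 4` (Koma's `2L`), for `g ≥ 0`, `β > 0`, any `B` and any `d` real functions `h`: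
`Tr exp[-βH(B, h)] ≤ Tr exp[-βH(B, 0)]`. [cite: Koma2022, Thm. 5.3 (5.100)] -/
theorem printed_partitionFn_le {β : ℝ} (hβ : 0 < β) (κ : ℝ) {g : ℝ} (hg : 0 ≤ g)
    (h : Fin (d + 1) → FermionTorus (d + 1) L → ℝ) (B : ℝ) :
    ((printedHamiltonian κ g h B).partitionFn β).re ≤
      ((printedHamiltonian κ g (fun (_ : Fin (d + 1)) (_ : FermionTorus (d + 1) L) => (0 : ℝ)) B).partitionFn β).re := by
  have h2 : 2 ≤ L := by omega
  rw [partitionFn_printed hL h4, partitionFn_printed hL h4, Complex.re_ofReal_mul, Complex.re_ofReal_mul,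
    bondField_zero (d := d) (L := L)]
  refine mul_le_mul_of_nonneg_left ?_ (Real.exp_pos _).le
  rcases le_or_gt 0 κ with hκ | hκ
  · exact partitionFn_le hL h4 hβ hκ _ hg _ B
  · rw [← partitionFn_neg_kappa hL h2 κ (-2 * (d + 1 : ℕ) * g) g (bondField h) B β,
      ← partitionFn_neg_kappa hL h2 κ (-2 * (d + 1 : ℕ) * g) g (fun (_ _ : FermionTorus (d + 1) L) => (0 : ℝ)) B β]
    exact partitionFn_le hL h4 hβ (by linarith : 0 ≤ -κ) _ hg _ B

end Conjugation

end KomaPiFlux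

end Literature.MathematicalPhysics.QuantumLattice

end
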